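import Literature.IUT.LogVolume.HolomorphicHull
import Literature.IUT.LogVolume.LogVolume
import Summits.ABC.IUTFork.LanaRssBridge
import Summits.ABC.IUTFork.Cor312HullFrameReal
import HarnessLib

/-!
# L-LANA objects V sexies: `ℝ^ss`, the `q`-region and the hull over the REAL container `⊕_j K_j` with its normalised Haar measure (LANA §5.2 (d)(e), §8.1 (f)(h), §9.2; N11/N15 hull RESOLVED)

Record-only file (D-0012) of the abc-iut cell (seat abc-iut-c312-4, L-LANA level; plan/LLANA-SPEC N15 with the
N11 pieces it needs); TAKES NO SIDE on [IUTchIII] Cor. 3.12. `LanaRss.lean` typed `ℝ^ss`, the `η`'s and (9-1) over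
an ARBITRARY measure space standing for the volume container, with the `q`-region, the hull `U^{hol}` and the
inclusion "every output region lies in the hull" (`EtaData.SuitableInHull`, §8.1 (f)) as DATA. Campaign S has
since CONSTRUCTED the container-level objects: a finite direct sum `⊕_j K_j` of nonarchimedean local fields (norm
presentation), its normalised Haar measure `μ_Λ` for an integral structure `Λ` (seat abc-iut-S2,
`Literature.IUT.LogVolume.NormalizedHaar` / `LogVolume`: "the notion of "volume" by Haar measure for measurable
subsets in `VC(K)`, which is normalized as: the volume of `VC(O)` is `1`", LANA §5.2 (e) p. 29), and the holomorphic
hull `holomorphicHull K U` = the smallest `λ·O_L ⊇ U` ([IUTchIII] Rmk. 3.9.5 (i); = LANA's "smallest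
`VC(O)`-submodule containing `S`", §5.2 (d), by the tree's `LanaHullSpan`). THIS FILE plugs them in:

* `hullSetRegion` — a hull-set `λ·O_L` (all `λ_j ≠ 0`) IS a region of `LanaRss` (measurable, `0 < μ_Λ < ∞`:
  it contains an open polydisc and is compact); in particular `qRegionOf q` = "the class of `{q̲_v O_v}` embedded
  "diagonally" into the large volume container" (§9.2 p. 46) for the element `q = (q̲_v)_j`;
* `hullRegion U` — for `U` bounded (= relatively compact) and nondegenerate (the printed condition "contains a
  relatively compact subset whose log-volume is finite", Rmk. 3.9.5 (i)), S2's `holomorphicHull K U` IS a region,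
  so "`−|log(Θ)| := log-vol((U^{hol})^{det})`" (§8.1 (h)) is a genuine real number here;
* `RealHullInput` ↦ `RealHullInput.etaData` — an `EtaData μ_Λ` (N15) whose `q`-region and hull are the REAL ones,
  from: `ℝ^val`, the element `q`, the output map `S ↦ LGP·S`, the suitable `S` ((Ind1–3), Step 9 — still the
  datum it is in print), and the union `⋃_λ U_λ` of the possible images with "`LGP·S ⊆ ⋃_λ U_λ` for suitable `S`";
  THEN `SuitableInHull` is a THEOREM (`RealHullInput.suitableInHull`, S2's `subset_holomorphicHull`), the hull
  is a hull-set (`isHullSet_hull`), it is the hull of c312-7's verbatim-form frame `HullFrame.ofLocalFields`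
  (`hull_carrier_eq_frame_hull`), `−|log(Θ)| = ` S2's `logVolume` of the real hull, and (9-1) ⟹ (8-1) reads
  `log μ_Λ(q·O_L) ≤ log μ_Λ(hull(⋃_λ U_λ))` (`cor312_of_mainGoal`);
* (sibling `LanaRealContainer.lean`) skel XVII's `VolumeContainer` on `(⊕_j K_j, μ_Λ)` with S2's
  `hullClosureOperator` and the admissibility of the hull of a bounded nondegenerate union — the datum `hhull`
  of gen-0's `LanaMeasureContainer.cor312Setting` — discharged there from `hullRegion`.

Modelling notes. (i) `J` indexes the direct-sum decomposition of the container into fields (Rmk. 3.9.5 (i)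
"relative to the direct sum decomposition of `𝓘^ℚ(−)` as a direct sum of fields"); which fields (`K_{S_{j+1},v}`
of LANA §5.2 (b), tensor packets [IUTchIII] Prop. 3.1) is campaign-S/c312-3 data (`TensorPacketRing`,
`PrimewisePackets`), not fixed here. (ii) `Λ` is any integral structure (`VC(O)` or the log-shell one `VC(I)`);
the procession normalisation is S2's `normalizedLogVolume`, a rescaling not needed for (8-1).
[cite: LANA2026Report, §5.2 (d)(e) p. 29, §8.1 (f)(h) p. 41, §9.2 p. 46] [cite: Mochizuki2012, IUTchIII Rmk. 3.9.5 (i) p. 127]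
NOT here: the possible images themselves (Thm. 3.11 / the `η`-algorithm output), (Ind1–3), any judgement.
-/

noncomputable section

open MeasureTheory Set Metric Bornology
open Literature.IUT.LogVolume

namespace Summit.ABC
namespace IUTFork

variable {J : Type} [Fintype J] (K : J → Type) [∀ j, NontriviallyNormedField (K j)]

/-! ## 1. Hull-sets `λ·O_L` and hulls are regions of `(⊕_j K_j, μ_Λ)` -/

section Compact

variable [∀ j, ProperSpace (K j)]

omit [Fintype J] in
/-- A polydisc `∏_j {‖x_j‖ ≤ r_j}` is compact (each `K_j` is proper). [folklore] -/
theorem isCompact_polydisc (r : J → ℝ) : IsCompact (polydisc K r) :=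
  isCompact_univ_pi fun j => isCompact_closedBall (0 : K j) (r j)

end Compact

variable [MeasurableSpace (Π j, K j)] [BorelSpace (Π j, K j)] (Λ : IntegralStructure (Π j, K j))

/-- A hull-set `λ·O_L` with every `λ_j ≠ 0` contains the nonempty OPEN polydisc `∏_j {‖x_j‖ < ‖λ_j‖}`, hence
has positive Haar measure. [cite: LANA2026Report, §5.2 (e) p. 29] -/
theorem haar_hullSet_pos (c : Π j, K j) (hc : ∀ j, c j ≠ 0) : 0 < Λ.haar (hullSet K c) := by
  have hopen : IsOpen (Set.pi univ fun j => ball (0 : K j) ‖c j‖) :=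
    isOpen_set_pi finite_univ fun j _ => isOpen_ball
  have hne : (Set.pi univ fun j => ball (0 : K j) ‖c j‖).Nonempty :=
    ⟨0, fun j _ => by simpa using norm_pos_iff.mpr (hc j)⟩
  have hsub : (Set.pi univ fun j => ball (0 : K j) ‖c j‖) ⊆ hullSet K c := fun x hx =>
    (mem_polydisc K).mpr fun j => le_of_lt (mem_ball_zero_iff.mp (hx j (mem_univ j)))
  exact (Λ.haar_pos_of_isOpen hopen hne).trans_le (measure_mono hsub)

variable [∀ j, ProperSpace (K j)]

omit [Fintype J] in
/-- A hull-set is compact, so of finite Haar measure. [cite: LANA2026Report, §5.2 (e) p. 29] -/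
theorem haar_hullSet_lt_top (c : Π j, K j) : Λ.haar (hullSet K c) < ⊤ :=
  Λ.haar_lt_top_of_isCompact (isCompact_polydisc K fun j => ‖c j‖)

/-- **A hull-set `λ·O_L` (all `λ_j ≠ 0`) is a region** of `ℝ^ss`'s underlying measure space (measurable, of
finite nonzero volume). [cite: LANA2026Report, §9.2 p. 46, §5.2 (e) p. 29] -/
def hullSetRegion (c : Π j, K j) (hc : ∀ j, c j ≠ 0) : Region Λ.haar where
  carrier := hullSet K c
  measurable := (isCompact_polydisc K fun j => ‖c j‖).isClosed.measurableSet
  vol_ne_zero := (haar_hullSet_pos K Λ c hc).ne'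
  vol_ne_top := (haar_hullSet_lt_top K Λ c).ne

/-- The carrier of `hullSetRegion c` is `λ·O_L`. [folklore] -/
@[simp] theorem hullSetRegion_carrier (c : Π j, K j) (hc : ∀ j, c j ≠ 0) :
    (hullSetRegion K Λ c hc).carrier = hullSet K c := rfl

/-- **The `q`-region** (§9.2 p. 46: "the pilot of the target `ℝ^ss` is given by the class of `{q̲_v O_v}` embedded
"diagonally" into the large volume container"): for the element `q = (q_j)_j` (the image of `q̲_v` in each direct
summand), the region `q·O_L = ∏_j {‖x_j‖ ≤ ‖q_j‖}`. [cite: LANA2026Report, §9.2 p. 46, §8.1 (a) p. 40] -/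
def qRegionOf (q : Π j, K j) (hq : ∀ j, q j ≠ 0) : Region Λ.haar := hullSetRegion K Λ q hq

/-- `−|log(q)|` of the real `q`-region "computed in the usual way" (§8.1 (a)) is S2's log-volume
`log μ_Λ(q·O_L)`. [cite: LANA2026Report, §8.1 (a) p. 40] -/
theorem qRegionOf_logVol (q : Π j, K j) (hq : ∀ j, q j ≠ 0) :
    (qRegionOf K Λ q hq).logVol = Λ.logVolume (hullSet K q) := rfl

variable [∀ j, IsUltrametricDist (K j)]

/-- **The holomorphic hull of a bounded nondegenerate set is a region**: S2's `holomorphicHull K U` is then a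
hull-set `λ·O_L` (`isHullSet_holomorphicHull`: the sup of the `j`-th norms is attained and nonzero), so
"`−|log(Θ)| := log-vol((U^{hol})^{det})`" (§8.1 (h)) is a real number. [cite: LANA2026Report, §8.1 (h) p. 41]
[cite: Mochizuki2012, IUTchIII Rmk. 3.9.5 (i) p. 127] -/
def hullRegion (U : Set (Π j, K j)) (hU : IsBounded U) (hnd : IsNondegenerate K U) : Region Λ.haar where
  carrier := holomorphicHull K U
  measurable := by
    rw [holomorphicHull_of_isBounded K hU]
    exact (isCompact_polydisc K _).isClosed.measurableSet
  vol_ne_zero := by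
    obtain ⟨c, hc, hH⟩ := isHullSet_holomorphicHull K hU hnd
    rw [hH]
    exact (haar_hullSet_pos K Λ c hc).ne'
  vol_ne_top := by
    rw [holomorphicHull_of_isBounded K hU]
    exact (Λ.haar_lt_top_of_isCompact (isCompact_polydisc K _)).ne

/-- The carrier of `hullRegion U` is S2's `holomorphicHull K U`. [folklore] -/
@[simp] theorem hullRegion_carrier (U : Set (Π j, K j)) (hU : IsBounded U) (hnd : IsNondegenerate K U) :
    (hullRegion K Λ U hU hnd).carrier = holomorphicHull K U := rfl

/-- log-vol of the hull region is S2's `logVolume` of the hull. [cite: LANA2026Report, §8.1 (h) p. 41] -/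
theorem hullRegion_logVol (U : Set (Π j, K j)) (hU : IsBounded U) (hnd : IsNondegenerate K U) :
    (hullRegion K Λ U hU hnd).logVol = Λ.logVolume (holomorphicHull K U) := rfl

/-- **Monotonicity at the real level**: a region inside a bounded nondegenerate `U` has log-volume at most that of
`U^{hol}` (§8.3 "contains … hence `≤`"). [cite: LANA2026Report, §8.3 p. 43] -/
theorem logVol_le_hullRegion (U : Set (Π j, K j)) (hU : IsBounded U) (hnd : IsNondegenerate K U)
    (T : Region Λ.haar) (hT : T.carrier ⊆ U) : T.logVol ≤ (hullRegion K Λ U hU hnd).logVol :=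
  T.logVol_mono _ (hT.trans (subset_holomorphicHull K U))

/-! ## 2. The `η`-datum with the REAL `q`-region and hull; `SuitableInHull` is a theorem -/

/-- **Input for the real `η`-datum** (LANA §8.1 (a)(c)(f), §9.2): `ℝ^val`; the `q`-pilot element `q = (q_j)_j`
(all `q_j ≠ 0`); the output map `S ↦ 1·S = LGP·S` and the family of suitable `S` ((Ind1)–(Ind3), `η`-algorithm
Step 9 — data, as in print); the union `⋃_λ U_λ` of the possible images of the Θ-pilot object (§8.1 (c)),
bounded (relatively compact) and nondegenerate, containing every output region `LGP·S` for suitable `S`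
(§8.1 (f): the hull is taken of the union). [cite: LANA2026Report, §8.1 (a)(c)(f) pp. 40–41, §9.2 p. 46] -/
structure RealHullInput : Type 1 where
  /-- `ℝ^val` -/
  Rval : PointedLine
  /-- the `q`-pilot element `(q_j)_j` -/
  q : Π j, K j
  /-- every component of `q` is nonzero -/
  q_ne : ∀ j, q j ≠ 0
  /-- `S ↦ 1·S = LGP·S` -/
  LGP : Region Λ.haar → Region Λ.haar
  /-- the suitable integral structures `S` -/
  Suitable : Set (Region Λ.haar)
  /-- `⋃_λ U_λ`, the union of the possible images of the Θ-pilot object -/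
  images : Set (Π j, K j)
  /-- … is relatively compact -/
  images_bounded : IsBounded images
  /-- … and nondegenerate (no coordinate vanishes identically: "contains a relatively compact subset whose
  log-volume is finite") -/
  images_nondegenerate : IsNondegenerate K images
  /-- every output region `LGP·S`, `S` suitable, is one of / lies in the possible images -/
  lgp_subset : ∀ S ∈ Suitable, (LGP S).carrier ⊆ images

namespace RealHullInput

variable {K Λ} (I : RealHullInput K Λ)

/-- The real `q`-region `q·O_L` of the input. [cite: LANA2026Report, §9.2 p. 46] -/
def qRegion : Region Λ.haar := qRegionOf K Λ I.q I.q_ne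

/-- The real hull `(⋃_λ U_λ)^{hol}` of the input. [cite: LANA2026Report, §8.1 (f) p. 41] -/
def hull : Region Λ.haar := hullRegion K Λ I.images I.images_bounded I.images_nondegenerate

/-- **The `η`-datum (N15 `EtaData`) with the REAL `q`-region and hull.** [cite: LANA2026Report, §9.2 p. 46] -/
def etaData : EtaData Λ.haar where
  Rval := I.Rval
  qRegion := I.qRegion
  LGP := I.LGP
  Suitable := I.Suitable
  hull := I.hull

/-- The hull of the `η`-datum IS S2's holomorphic hull of `⋃_λ U_λ`. [cite: LANA2026Report, §8.1 (f) p. 41] -/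
@[simp] theorem etaData_hull_carrier : I.etaData.hull.carrier = holomorphicHull K I.images := rfl

/-- The `q`-region of the `η`-datum IS `q·O_L`. [cite: LANA2026Report, §9.2 p. 46] -/
@[simp] theorem etaData_qRegion_carrier : I.etaData.qRegion.carrier = hullSet K I.q := rfl

/-- **`SuitableInHull` is a THEOREM for the real hull** (§8.1 (f) "one takes the holomorphic hull" of the
union): every output region `LGP·S`, `S` suitable, lies in `(⋃_λ U_λ)^{hol}` — S2's `subset_holomorphicHull`.
[cite: LANA2026Report, §8.1 (f) p. 41] -/
theorem suitableInHull : I.etaData.SuitableInHull := fun S hS =>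
  (I.lgp_subset S hS).trans (subset_holomorphicHull K I.images)

/-- The real hull is a hull-set `λ·O_L` (every `λ_j ≠ 0`) — [IUTchIII] Rmk. 3.9.5 (i) "the smallest subset of
the form `λ·𝒪` … that contains `U`". [cite: Mochizuki2012, IUTchIII Rmk. 3.9.5 (i) p. 127] -/
theorem isHullSet_hull : IsHullSet K I.etaData.hull.carrier :=
  isHullSet_holomorphicHull K I.images_bounded I.images_nondegenerate

/-- **Agreement with the verbatim form's frame**: the hull of the `η`-datum is the hull of `⋃_λ U_λ` in c312-7's
REAL hull frame `Cor312.HullFrame.ofLocalFields K` of `Cor312Statement` (hence, by c312-6/L6-t4's bridges, the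
hull of the verbatim Cor. 3.12). [cite: Mochizuki2012, IUTchIII Rmk. 3.9.5 (i) p. 127] -/
theorem hull_carrier_eq_frame_hull :
    I.etaData.hull.carrier = (Cor312.HullFrame.ofLocalFields K).hull I.images :=
  (Cor312.HullFrame.ofLocalFields_hull_eq K I.images_bounded I.images_nondegenerate).symm

/-- **`−|log(Θ)|`** of the `η`-datum (§8.1 (h) "The value log-vol(`(U^{hol})^{det}`) is `−|log(Θ)|`") is S2's
log-volume `log μ_Λ((⋃_λ U_λ)^{hol})`. [cite: LANA2026Report, §8.1 (h) p. 41] -/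
theorem negAbsLogTheta_eq : I.etaData.negAbsLogTheta = Λ.logVolume (holomorphicHull K I.images) := rfl

/-- **`−|log(q)|`** of the `η`-datum (§8.1 (a)) is `log μ_Λ(q·O_L)`. [cite: LANA2026Report, §8.1 (a) p. 40] -/
theorem negAbsLogq_eq : I.etaData.negAbsLogq = Λ.logVolume (hullSet K I.q) := rfl

/-- Every suitable output region has log-volume `≤ −|log(Θ)|` (skel VIII's posited `vol_le_hull`, here a
theorem about Haar measure). [cite: LANA2026Report, §8.3 p. 43] -/
theorem logVol_lgp_le_negAbsLogTheta (S : Region Λ.haar) (hS : S ∈ I.Suitable) :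
    (I.LGP S).logVol ≤ I.etaData.negAbsLogTheta :=
  (I.LGP S).logVol_mono I.etaData.hull (I.suitableInHull S hS)

/-- **(9-1) ⟹ (8-1) over the real container**: if some suitable `LGP·S` has the volume of `q·O_L` (LANA's main
goal (9-1) for this datum), then `log μ_Λ(q·O_L) ≤ log μ_Λ((⋃_λ U_λ)^{hol})`, i.e. `−|log(q)| ≤ −|log(Θ)|` — with NO
inclusion hypothesis left (gen-0 `EtaData.cor312_of_mainGoal` + `suitableInHull`).
[cite: LANA2026Report, §8.3 p. 43, §9 p. 44, §9.2 (9-1) p. 46] -/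
theorem cor312_of_mainGoal (h : I.etaData.MainGoal) :
    Λ.logVolume (hullSet K I.q) ≤ Λ.logVolume (holomorphicHull K I.images) :=
  I.etaData.cor312_of_mainGoal I.suitableInHull h

/-- The skeleton's `OutputRegions` (VIII) carried by the real `η`-datum — no hypothesis left (gen-0
`EtaData.toOutputRegions` needed `SuitableInHull`). [cite: LANA2026Report, §9.2 p. 46, §8.1 (f),(h) p. 41] -/
def outputRegions : OutputRegions := I.etaData.toOutputRegions I.suitableInHull

/-- (9-1) for the real datum ⟺ VIII's `Represented` for the carried output regions.
[cite: LANA2026Report, §9.3 p. 46] -/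
theorem mainGoal_iff_represented : I.etaData.MainGoal ↔ I.outputRegions.Represented :=
  I.etaData.mainGoal_iff_represented I.suitableInHull

/-- (9-1) is still NOT automatic over the real container: with no suitable `S` it fails (gen-0 vacuity check,
unchanged by making the hull real — (9-1) is a statement about WHICH `S` are suitable).
[cite: LANA2026Report, Rem. 8.2.1 p. 42, §10.4 p. 49] -/
theorem not_mainGoal_of_suitable_empty (h : I.Suitable = ∅) : ¬ I.etaData.MainGoal :=
  I.etaData.not_mainGoal_of_suitable_empty h

end RealHullInput

end IUTFork

end Summit.ABC

end
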